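import Summits.Ventures.HSemireg.WedgeHankelRecurrenceDistinctRoots

/-!
# Venture HSemireg — HERMITE–SYLVESTER COMMON-ROOT COUNT: THE RANK OF THE WEIGHTED HANKEL FORM `H_t(a·m′/m)`. For `m` monic of degree `t + 1`, any weight `a ∈ K[X]` and any field embedding
# `φ : K → L` under which `m` splits, **`rank (dualSeq m (a·m′) (i + j))_{i,j ≤ t} = #{λ ∈ roots(φ m) : e_λ ≠ 0 in L ∧ a(λ) ≠ 0}`** — the weighted form counts the distinct roots of `m` (multiplicity
# prime to the characteristic) AT WHICH `a` DOES NOT VANISH; hence **`rank H_t(m′/m) − rank H_t(a·m′/m) = #{distinct common roots of m and a}`** (characteristic `0`; in general those with `e_λ ≠ 0`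
# in `L`), and over ANY field, with no splitting, **`rank H_t(b/m) = deg (m / gcd(m, b))`** for every numerator `b` (Kronecker's reduced denominator; N96 rewritten).

HONEST FRAMING. Part of the Lean index of the computation cell `pub-hsemireg` (seat p10 gen 32, Sunday typer «UNIFORM-IN-n»).
LINEAR ALGEBRA OF HANKEL (catalecticant) MATRICES and of polynomials over a field ONLY (`Polynomial.rootMultiplicity`, `Polynomial.roots`, `EuclideanDomain.gcd`, Euclidean division): no variety, no
cohomology theory, no sheaf, no Ext group and no semiregularity map is constructed here; nothing here says that HC / HC_CM / HC_AV holds; no Literature FACT is declared or used.  Custodian versions as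
in `WedgeHankelSiegelIdeal` (1/3).

WHAT IS IN THE TREE.  N96 (`WedgeHankelRecurrenceSeparable`): `rank_hankelSq_dualSeq` (`rank H_t(b/m) = t + 1 − deg gcd(m, b)` for ANY `b`).  N108 (`WedgeHankelRecurrenceSylvester`): `det H_t(a·m′/m) = N(a)·disc m`,
`≠ 0 ⟺ (m, a) = 1 ∧ m` separable (the full-rank case of this file), `dualSeq_multiset_prod_X_sub_C_mul_derivative` (the weighted power sums `Σ a(λ) λ^j`).  N110 (`WedgeHankelRecurrenceDistinctRoots`):
`rootMultiplicity_gcd`, `rootMultiplicity_derivative_of_cast_rootMultiplicity_ne_zero`, `rootMultiplicity_le_rootMultiplicity_derivative_of_cast_eq_zero`, `cast_rootMultiplicity_eq_zero_of_derivative_eq_zero`,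
`rank_hankelSq_dualSeq_derivative_eq_card_filter_map` (the case `a = 1`).  PROVED Literature `Algebra/Polynomial/TraceFormRootCounting` ∕ `TraceFormSignature` (Laurent 2008 (2.14)–(2.15), Thm. 2.14:
for a 0-dimensional RADICAL ideal `I ⊆ ℝ[x]` and `h ∈ ℝ[x]`, `rank S_h = |{v ∈ V_ℂ(I) : h(v) ≠ 0}|`, signature counts signs) — the real, radical, multivariate statement; NOT imported; this file is the
univariate version WITH MULTIPLICITIES over EVERY field and characteristic, in the lineage's Hankel vocabulary.  Mathlib: `rootMultiplicity_mul`, `rootMultiplicity_pos`, `isRoot_map_iff`, `gcd_map`,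
`Finset.card_filter_add_card_filter_not`.
THIS FILE (namespace `Summit.Ventures.HSemireg.Wedge.HankelOuter` continued; CHAINED on N110; 0 definitions):
* §678 any numerator, any field: `gcd_mul_div_gcd` (`gcd(m, b) · (m / gcd(m, b)) = m`), `natDegree_div_gcd_add`, **`rank_hankelSq_dualSeq_eq_natDegree_div_gcd`** (`rank H_t(b/m) = deg (m / gcd(m, b))`).
* §679 multiplicities: **`count_roots_gcd_mul_derivative`** (multiplicity of `λ` in `gcd(m, a·m′)` = `e_λ − [e_λ ≠ 0 in K ∧ a(λ) ≠ 0]`, every characteristic, `m ≠ 0`),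
  **`natDegree_gcd_mul_derivative_add_card_filter`** (`deg gcd(m, a·m′) + #{λ : e_λ ≠ 0 ∧ a(λ) ≠ 0} = deg m`, split `m`).
* §680 **`rank_hankelSq_dualSeq_mul_derivative_eq_card_filter_map`** (THE WEIGHTED ROOT COUNT under any splitting embedding), `…_eq_card_filter` (split over `K`),
  **`rank_hankelSq_dualSeq_mul_derivative_eq_card_filter_not_isRoot_map`** (characteristic `0`: `= #{distinct roots of m with a(λ) ≠ 0}`),
  **`rank_hankelSq_dualSeq_mul_derivative_add_card_common`** (`rank H_t(a·m′/m) + #{λ : e_λ ≠ 0 ∧ a(λ) = 0} = rank H_t(m′/m)`: THE COMMON-ROOT COUNT as a rank drop),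
  `rank_hankelSq_dualSeq_mul_derivative_add_card_common_of_charZero` (characteristic `0`: the drop is the number of distinct common roots of `m` and `a`),
  `rank_hankelSq_dualSeq_mul_derivative_le` (`≤ rank H_t(m′/m)`), `rank_hankelSq_dualSeq_mul_derivative_eq_zero_iff_of_charZero` (`= 0 ⟺ a` vanishes at every root of `m`, i.e. `rad m ∣ a` in root form).
Nothing Ext-side.  New names only.
-/

open Module Polynomial
open scoped Matrix Polynomial

namespace Summit.Ventures.HSemireg.Wedge.HankelOuter

open Summit.Ventures.HSemireg.Wedge Summit.Ventures.HSemireg.Wedge.Hankel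

variable (K : Type*) [Field K]

/-! ## §678. Any numerator: `rank H_t(b/m) = deg (m / gcd(m, b))` -/

/-- `gcd(m, b) · (m / gcd(m, b)) = m` (exact Euclidean division in `K[X]`; also for `m = 0`). -/
theorem gcd_mul_div_gcd [DecidableEq K] (m b : K[X]) : EuclideanDomain.gcd m b * (m / EuclideanDomain.gcd m b) = m := by
  rcases eq_or_ne m 0 with rfl | hm
  · rw [EuclideanDomain.gcd_zero_left, EuclideanDomain.zero_div, mul_zero]
  · exact EuclideanDomain.mul_div_cancel' (fun h => hm (EuclideanDomain.gcd_eq_zero_iff.mp h).1) (EuclideanDomain.gcd_dvd_left m b)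

/-- `deg (m / gcd(m, b)) + deg gcd(m, b) = deg m` (`m ≠ 0`). -/
theorem natDegree_div_gcd_add [DecidableEq K] {m : K[X]} (hm : m ≠ 0) (b : K[X]) :
    (m / EuclideanDomain.gcd m b).natDegree + (EuclideanDomain.gcd m b).natDegree = m.natDegree := by
  have hg : EuclideanDomain.gcd m b ≠ 0 := fun h => hm (EuclideanDomain.gcd_eq_zero_iff.mp h).1
  have hq : m / EuclideanDomain.gcd m b ≠ 0 := fun h => by have h2 := gcd_mul_div_gcd K m b; rw [h, mul_zero] at h2; exact hm h2.symm
  conv_rhs => rw [← gcd_mul_div_gcd K m b]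
  rw [Polynomial.natDegree_mul hg hq, add_comm]

/-- **KRONECKER'S THEOREM, REDUCED-DENOMINATOR FORM: `rank (dualSeq m b (i + j))_{i,j ≤ t} = deg (m / gcd(m, b))`** for `m` monic of degree `t + 1` and ANY numerator `b`, over ANY field (N96's
`t + 1 − deg gcd(m, b)` rewritten: the rank of the square Hankel matrix of the symbol `b/m` is the degree of its reduced denominator). -/
theorem rank_hankelSq_dualSeq_eq_natDegree_div_gcd [DecidableEq K] {t : ℕ} {m : K[X]} (hm : m.Monic) (hmd : m.natDegree = t + 1) (b : K[X]) :
    (hankelSq K t (dualSeq K m b)).rank = (m / EuclideanDomain.gcd m b).natDegree := by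
  rw [rank_hankelSq_dualSeq K hm hmd b]
  have h := natDegree_div_gcd_add K hm.ne_zero b
  omega

/-! ## §679. Root multiplicities of `gcd(m, a·m′)` -/

/-- **The multiplicity of `λ` in `gcd(m, a·m′)` is `e_λ − [e_λ ≠ 0 in K ∧ a(λ) ≠ 0]`** (`m ≠ 0`, `e_λ` = multiplicity of `λ` in `m`, every characteristic): the weight `a` restores the missing unit of
multiplicity exactly at its own roots. -/
theorem count_roots_gcd_mul_derivative [DecidableEq K] {m : K[X]} (hm : m ≠ 0) (a : K[X]) (c : K) :
    (EuclideanDomain.gcd m (a * derivative m)).roots.count c = m.roots.count c - (if ((m.roots.count c : ℕ) : K) = 0 ∨ a.IsRoot c then 0 else 1) := by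
  rw [count_roots, count_roots]
  by_cases h0 : a * derivative m = 0
  · -- `gcd(m, 0) = m`; and either `a = 0` (so `a(c) = 0`) or `m′ = 0` (so `e = 0` in `K`)
    rw [h0, EuclideanDomain.gcd_zero_right, if_pos, Nat.sub_zero]
    rcases mul_eq_zero.mp h0 with ha | hd
    · exact Or.inr (by rw [ha]; exact Polynomial.IsRoot.def.mpr (Polynomial.eval_zero))
    · exact Or.inl (cast_rootMultiplicity_eq_zero_of_derivative_eq_zero K hm hd c)
  · have ha : a ≠ 0 := fun h => h0 (by rw [h, zero_mul])
    have hd : derivative m ≠ 0 := fun h => h0 (by rw [h, mul_zero])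
    rw [rootMultiplicity_gcd K hm h0, Polynomial.rootMultiplicity_mul h0]
    by_cases he : ((rootMultiplicity c m : ℕ) : K) = 0
    · rw [if_pos (Or.inl he), Nat.sub_zero]
      exact min_eq_left ((rootMultiplicity_le_rootMultiplicity_derivative_of_cast_eq_zero K hd he).trans (Nat.le_add_left _ _))
    · rw [rootMultiplicity_derivative_of_cast_rootMultiplicity_ne_zero K he]
      have he1 : 1 ≤ rootMultiplicity c m := Nat.one_le_iff_ne_zero.mpr fun h => he (by rw [h, Nat.cast_zero])
      by_cases hr : a.IsRoot c
      · rw [if_pos (Or.inr hr), Nat.sub_zero]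
        have h1 : 1 ≤ rootMultiplicity c a := (Polynomial.rootMultiplicity_pos ha).mpr hr
        exact min_eq_left (by omega)
      · rw [if_neg (not_or.mpr ⟨he, hr⟩), Polynomial.rootMultiplicity_eq_zero hr, zero_add]
        exact min_eq_right (Nat.sub_le _ 1)

/-- **`deg gcd(m, a·m′) + #{λ ∈ roots m : e_λ ≠ 0 in K ∧ a(λ) ≠ 0} = deg m`** for split `m ≠ 0` (every characteristic). -/
theorem natDegree_gcd_mul_derivative_add_card_filter [DecidableEq K] {m : K[X]} (hm : m ≠ 0) (hs : m.Splits) (a : K[X]) :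
    (EuclideanDomain.gcd m (a * derivative m)).natDegree + (m.roots.toFinset.filter fun c => ((m.roots.count c : ℕ) : K) ≠ 0 ∧ ¬ a.IsRoot c).card = m.natDegree := by
  set g := EuclideanDomain.gcd m (a * derivative m) with hg
  have hgm : g ∣ m := EuclideanDomain.gcd_dvd_left m _
  have hgs : g.Splits := hs.of_dvd hm hgm
  have hsub : ∀ c ∈ g.roots, c ∈ m.roots.toFinset := fun c hc => Multiset.mem_toFinset.mpr (Multiset.mem_of_le (roots.le_of_dvd hm hgm) hc)
  rw [hgs.natDegree_eq_card_roots, hs.natDegree_eq_card_roots, ← Multiset.sum_count_eq_card hsub, ← Multiset.toFinset_sum_count_eq m.roots, Finset.card_filter, ← Finset.sum_add_distrib]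
  refine Finset.sum_congr rfl fun c hc => ?_
  have h1 : 1 ≤ m.roots.count c := Multiset.one_le_count_iff_mem.mpr (Multiset.mem_toFinset.mp hc)
  rw [hg, count_roots_gcd_mul_derivative K hm a c]
  by_cases h : ((m.roots.count c : ℕ) : K) = 0 ∨ a.IsRoot c
  · rw [if_pos h, if_neg (fun h' => h'.elim fun h1' h2' => h.elim h1' h2'), Nat.sub_zero, Nat.add_zero]
  · rw [if_neg h, if_pos (not_or.mp h)]
    omega

/-! ## §680. The weighted root count and the common-root count -/

/-- **THE WEIGHTED ROOT COUNT: `rank (dualSeq m (a·m′) (i + j))_{i,j ≤ t} = #{λ ∈ roots(φ m) : e_λ ≠ 0 in L ∧ (φa)(λ) ≠ 0}`** for `m` monic of degree `t + 1`, any `a`, and any field embedding `φ` under which `m`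
splits (every characteristic). -/
theorem rank_hankelSq_dualSeq_mul_derivative_eq_card_filter_map [DecidableEq K] {L : Type*} [Field L] [DecidableEq L] (φ : K →+* L) {t : ℕ} {m : K[X]} (hm : m.Monic)
    (hmd : m.natDegree = t + 1) (hs : (m.map φ).Splits) (a : K[X]) :
    (hankelSq K t (dualSeq K m (a * derivative m))).rank
      = ((m.map φ).roots.toFinset.filter fun c => (((m.map φ).roots.count c : ℕ) : L) ≠ 0 ∧ ¬ (a.map φ).IsRoot c).card := by
  rw [rank_hankelSq_dualSeq K hm hmd]
  have h := natDegree_gcd_mul_derivative_add_card_filter L (hm.map φ).ne_zero hs (a.map φ)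
  rw [Polynomial.derivative_map, ← Polynomial.map_mul, Polynomial.gcd_map, Polynomial.natDegree_map, Polynomial.natDegree_map, hmd] at h
  omega

/-- The split case over `K` itself: `rank H_t(a·m′/m) = #{λ ∈ roots m : e_λ ≠ 0 in K ∧ a(λ) ≠ 0}`. -/
theorem rank_hankelSq_dualSeq_mul_derivative_eq_card_filter [DecidableEq K] {t : ℕ} {m : K[X]} (hm : m.Monic) (hmd : m.natDegree = t + 1) (hs : m.Splits) (a : K[X]) :
    (hankelSq K t (dualSeq K m (a * derivative m))).rank = (m.roots.toFinset.filter fun c => ((m.roots.count c : ℕ) : K) ≠ 0 ∧ ¬ a.IsRoot c).card := by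
  have h := rank_hankelSq_dualSeq_mul_derivative_eq_card_filter_map K (RingHom.id K) hm hmd (by rwa [Polynomial.map_id]) a
  rwa [Polynomial.map_id, Polynomial.map_id] at h

/-- **Characteristic `0`: `rank H_t(a·m′/m)` = THE NUMBER OF DISTINCT ROOTS OF `m` AT WHICH `a` DOES NOT VANISH** (in any `L ⊇ K` of characteristic `0` over which `m` splits). -/
theorem rank_hankelSq_dualSeq_mul_derivative_eq_card_filter_not_isRoot_map [DecidableEq K] {L : Type*} [Field L] [DecidableEq L] [CharZero L] (φ : K →+* L) {t : ℕ} {m : K[X]}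
    (hm : m.Monic) (hmd : m.natDegree = t + 1) (hs : (m.map φ).Splits) (a : K[X]) :
    (hankelSq K t (dualSeq K m (a * derivative m))).rank = ((m.map φ).roots.toFinset.filter fun c => ¬ (a.map φ).IsRoot c).card := by
  rw [rank_hankelSq_dualSeq_mul_derivative_eq_card_filter_map K φ hm hmd hs a]
  exact congrArg Finset.card (Finset.filter_congr fun c hc => and_iff_right (Nat.cast_ne_zero.mpr (Multiset.count_ne_zero.mpr (Multiset.mem_toFinset.mp hc))))

/-- **THE COMMON-ROOT COUNT AS A RANK DROP: `rank H_t(a·m′/m) + #{λ ∈ roots(φ m) : e_λ ≠ 0 in L ∧ (φa)(λ) = 0} = rank H_t(m′/m)`** (every characteristic): weighting the Newton sums by `a` kills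
exactly the distinct roots (of multiplicity prime to the characteristic) that `m` shares with `a`. -/
theorem rank_hankelSq_dualSeq_mul_derivative_add_card_common [DecidableEq K] {L : Type*} [Field L] [DecidableEq L] (φ : K →+* L) {t : ℕ} {m : K[X]} (hm : m.Monic)
    (hmd : m.natDegree = t + 1) (hs : (m.map φ).Splits) (a : K[X]) :
    (hankelSq K t (dualSeq K m (a * derivative m))).rank + ((m.map φ).roots.toFinset.filter fun c => (((m.map φ).roots.count c : ℕ) : L) ≠ 0 ∧ (a.map φ).IsRoot c).card
      = (hankelSq K t (dualSeq K m (derivative m))).rank := by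
  rw [rank_hankelSq_dualSeq_mul_derivative_eq_card_filter_map K φ hm hmd hs a, rank_hankelSq_dualSeq_derivative_eq_card_filter_map K φ hm hmd hs, ← Finset.filter_filter,
    ← Finset.filter_filter, add_comm]
  convert Finset.card_filter_add_card_filter_not (s := (m.map φ).roots.toFinset.filter fun c => (((m.map φ).roots.count c : ℕ) : L) ≠ 0) fun c => (a.map φ).IsRoot c using 3

/-- **Characteristic `0`: `rank H_t(m′/m) − rank H_t(a·m′/m) = #{distinct common roots of m and a}`** (written additively; in any `L ⊇ K` of characteristic `0` over which `m` splits). -/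
theorem rank_hankelSq_dualSeq_mul_derivative_add_card_common_of_charZero [DecidableEq K] {L : Type*} [Field L] [DecidableEq L] [CharZero L] (φ : K →+* L) {t : ℕ} {m : K[X]}
    (hm : m.Monic) (hmd : m.natDegree = t + 1) (hs : (m.map φ).Splits) (a : K[X]) :
    (hankelSq K t (dualSeq K m (a * derivative m))).rank + ((m.map φ).roots.toFinset.filter fun c => (a.map φ).IsRoot c).card = (hankelSq K t (dualSeq K m (derivative m))).rank := by
  rw [← rank_hankelSq_dualSeq_mul_derivative_add_card_common K φ hm hmd hs a]
  congr 2
  exact Finset.filter_congr fun c hc => (and_iff_right (Nat.cast_ne_zero.mpr (Multiset.count_ne_zero.mpr (Multiset.mem_toFinset.mp hc)))).symm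

/-- `rank H_t(a·m′/m) ≤ rank H_t(m′/m)` (`m` monic of degree `t + 1`, any `a`, any field — through the splitting field). -/
theorem rank_hankelSq_dualSeq_mul_derivative_le [DecidableEq K] {t : ℕ} {m : K[X]} (hm : m.Monic) (hmd : m.natDegree = t + 1) (a : K[X]) :
    (hankelSq K t (dualSeq K m (a * derivative m))).rank ≤ (hankelSq K t (dualSeq K m (derivative m))).rank := by
  classical
  rw [← rank_hankelSq_dualSeq_mul_derivative_add_card_common K (algebraMap K m.SplittingField) hm hmd (SplittingField.splits m) a]
  exact Nat.le_add_right _ _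

/-- **Characteristic `0`: `rank H_t(a·m′/m) = 0 ⟺ a` vanishes at EVERY root of `m`** (in any `L ⊇ K` of characteristic `0` over which `m` splits; equivalently the radical of `m` divides `a`). -/
theorem rank_hankelSq_dualSeq_mul_derivative_eq_zero_iff_of_charZero [DecidableEq K] {L : Type*} [Field L] [DecidableEq L] [CharZero L] (φ : K →+* L) {t : ℕ} {m : K[X]}
    (hm : m.Monic) (hmd : m.natDegree = t + 1) (hs : (m.map φ).Splits) (a : K[X]) :
    (hankelSq K t (dualSeq K m (a * derivative m))).rank = 0 ↔ ∀ c ∈ (m.map φ).roots, (a.map φ).IsRoot c := by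
  rw [rank_hankelSq_dualSeq_mul_derivative_eq_card_filter_not_isRoot_map K φ hm hmd hs a, Finset.card_eq_zero, Finset.filter_eq_empty_iff]
  exact ⟨fun h c hc => not_not.mp (h (Multiset.mem_toFinset.mpr hc)), fun h c hc => not_not.mpr (h c (Multiset.mem_toFinset.mp hc))⟩

end Summit.Ventures.HSemireg.Wedge.HankelOuter
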